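import Summits.QuantumFields.YangMills.Theorems.BalabanUVNodesN08HaarCompatibilityGuardJacobianSharpNormScalar

/-!
# BalabanUVNodes ∕ N08 — THE SHARP HILBERT–SCHMIDT JACOBIAN BOUND OF THE PRINTED exp-mean-log FIBRE MAP:
# `(1 − Σcᵢ)²·hs(X, X) ≤ hs(D K_W(W X), D K_W(W X))` — n08-w3's conjecture («σ_min ≥ 1 − Σcᵢ», p607823) in full, equality at the flat background

WIDTH SEAT `pub-ymgap-dag-n08-w6` g3 (R399 (3a) second wave; self-located CLAIM-2 of record HOME INBOX l.30413, successor of CLAIM-1 = p609767 ✓ ∕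
p610204 ✓), 2026-08-28.  Track A, DAG node N08 = [Balaban1985UV3] Thm 1 p. 257 (compact) + Thm 2 p. 272; key item K1⁷ `StabilityBAtRecordR13SepCoPH`
(stmt-QuantumFields-20542), `--supports … --as helper`.  COUNT-NEUTRAL.  Part 3b of the `…GuardJacobianSharp*` series (parts 1∕2: `…SharpFrame`, `…Sharp`;
part 3a `…SharpNormScalar` = the scalar input (S3)).

THE POINT.  `K_W = exp(Σᵢ cᵢ log(hᵢ W*))·W` (unitary `W`, unitaries `hᵢ` in the guard `‖hᵢW* − 1‖ < 1∕2`, `cᵢ ≥ 0`, `μ := Σcᵢ ≤ 1`, `λ := 1 − μ`),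
`Zᵢ = log(hᵢW*)`, `Y = ΣcᵢZᵢ`, `B_Z = (i∕2)ad_Z`, `φ(β) = β cot β`, `χ(β) = β∕sin β`.  On skew-Hermitian `X̃ = WXW*` the tangent map of `K` at `W` is
`(unitary)·χ(B_Y)⁻¹·Q`, `Q = φ(B_Y) − Σcᵢφ(B_{Zᵢ})` symmetric.  Sibling n08-w3's p607823 proved `‖D K_W(WX)‖_HS ≥ λ·(sin ρ∕ρ)·‖X‖_HS` and
CONJECTURED the sharp constant `λ` (numerics of both seats: never violated; `emlD_flat`: attained at the flat background); part 2 proved the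
determinant∕eigenvalue form `Q ⪰ λ·χ(B_Y)`.  THIS FILE PROVES THE NORM FORM: `‖χ(B_Y)⁻¹ Q X̃‖ ≥ λ‖X̃‖`, i.e.
  ★★★ `(1 − Σcᵢ)²·hs(X, X) ≤ hs(D K_W(W X), D K_W(W X))`  (`emlD_tangent_lower_bound_sharp`)
— p607823's `emlD_tangent_lower_bound` WITHOUT the `sin ρ∕ρ`, no `ρ`-hypothesis, `Σcᵢ ≤ 1` allowed.
MECHANISM.  With `P := Q − λχ(B_Y)` and `D := χ(B_Y)⁻¹` (multiplier `sinc β_{ab}` in `Y`'s eigenframe),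
`‖DQx‖² = ‖λx + DPx‖² = λ²‖x‖² + 2λ⟨Dx, Px⟩ + ‖DPx‖²`; completing the square ENTRYWISE in the frame (`entry_completion`:
`s²|p|² − 2λ(1−s)|x||p| ≥ −λ²((1−s)∕s)²|x|²`, `s = sinc β_{ab}`) gives `‖DQx‖² − λ²‖x‖² ≥ 2λ·[⟨x,Px⟩ − (λ∕2)·‖(χ(B_Y) − 1)x‖²]`, so the norm bound
follows from the STRENGTHENED coercivity `⟨x, Px⟩ ≥ (λ∕2)·‖(χ − 1)x‖²` AT THE SAME VECTOR — no commutation of `P` with `χ(B_Y)` is needed (this is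
what the scope note of part 2 missed).  Since the perspective-Jensen step already yields `Q ⪰ k(B_Y)`, `k(β) = φ(β) − μφ(β∕μ)`, a function of `B_Y`
alone (`sum_hs_le_persp_frame` + `hs_solution_eq`), the strengthened coercivity is part 3a's scalar (S3) entrywise (`sharp_coercive_strong`:
`λ·hs(X,G♭) + (λ∕2)·hs(G♭ − X, G♭ − X) ≤ hs(X,H_Y) − Σcᵢhs(X,Hᵢ)`).

WHAT THIS FILE PROVES ([folklore] matrix analysis over parts 1∕2∕3a, p607823 and pub-balaban's `T4EMLTangentInjective` BY IMPORT; nothing of Bałaban's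
asserted; 0 `def`).  §2 `sum_hs_le_persp_frame` (the perspective-Jensen half of `sharp_coercive` as a frame inequality) · `hs_flat_sub_self_eq` ·
★★ `sharp_coercive_strong`.  §3 `entry_completion` · ★★★ `emlD_tangent_lower_bound_sharp` · `emlD_tangent_lower_bound_sharp_specialUnitary`
(the typed guard `deltaSU` of `expMeanLogSU`, every `N`).  Consequence for a fibre-law density constant (not typed here): every singular value of
`D K_W` on `su(N)` lies in `[λ, ·]`, so `|det D K_W| ≥ λ^{N²−1}` per bond with `λ = L^{1−d}` at the [B10] slot — the optimum.

HONEST FRAMING.  Count-neutral helper ([folklore] matrix analysis about the printed (0.4) ∕ (1.4) fibre map); no quantitative `T4HaarSUNLocalDiffeo` (density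
form) is typed here; E6′ NOT decided; `hmass` NOT supplied; N08 NOT discharged; counts unmoved (typed 28∕28 · discharged 5∕27); no summit statement is proved
by this seat — one finite 𝕋⁴ programme at fixed ε, R4 closes the CONDITIONAL rung `BalabanLadder.UV` only; the Yang–Mills mass gap (Clay) is NOT proved by
any of this; nothing continuum ∕ ℝ⁴ ∕ OS ∕ mass gap.  0 `sorry`, 0 `def`, 0 `instance`, 0 `notation`, standard axioms.
-/

noncomputable section

open NormedSpace Finset
open scoped Matrix Matrix.Norms.L2Operator ComplexConjugate Nat

namespace Summit.QuantumFields.YangMills.BalabanUVNodes.N08HaarCompatibilityGuardJacobianSharpNorm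

open Literature.MathematicalPhysics.QuantumFieldTheory.Balaban1983to89
open Literature.MathematicalPhysics.QuantumFieldTheory.Balaban1983to89.T4EMLTangentInjective
open Summit.QuantumFields.YangMills.BalabanUVNodes.N08HaarCompatibilityGuardJacobian
open Summit.QuantumFields.YangMills.BalabanUVNodes.N08HaarCompatibilityGuardJacobianSharpFrame
open Summit.QuantumFields.YangMills.BalabanUVNodes.N08HaarCompatibilityGuardJacobianSharp
open Summit.QuantumFields.YangMills.BalabanUVNodes.N08HaarCompatibilityGuardJacobianSharpNormScalar
open Matrix (single diagonal unitaryGroup)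
open Complex (I)
open Literature.MathematicalPhysics.QuantumFieldTheory.Balaban1983to89.MatrixLog (mlog)
open T4QuatExpLog (ψ ψ_zero ψ_of_ne_zero)

variable {m : Type*} [Fintype m] [DecidableEq m] [Nonempty m] {ι : Type*} [Fintype ι]

/-! ## §2 The strengthened sharp coercivity `Q ⪰ λ·χ(B_Y) + (λ∕2)·(χ(B_Y) − 1)²` -/

/-- **The perspective-Jensen half of `sharp_coercive`, as a frame inequality.**  In an eigenframe `Y = Σcᵢ Zᵢ = U diag(−iθ) U*`
with `|θₐ| ≤ μ := Σcᵢ`: `Σcᵢ·hs(X, Hᵢ) ≤ Σ_{ab} |X'_{ab}|²·μ·(1 − ψ(β_{ab}∕μ))` — pub-balaban's KEY + `jensen_step` at the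
normalised weights `cᵢ∕μ` (`Ŷ = Y∕μ` has the same frame, angles `θ∕μ`). [folklore] -/
theorem sum_hs_le_persp_frame {U : Matrix m m ℂ} (hU : star U * U = 1) (hU' : U * star U = 1) (θ : m → ℝ)
    {Z : ι → Matrix m m ℂ} (hZ : ∀ i, (Z i)ᴴ = -Z i) (hZ1 : ∀ i, ‖Z i‖ ≤ 1) (c : ι → ℝ) (hc0 : ∀ i, 0 ≤ c i)
    (hYU : ∑ i, (c i : ℂ) • Z i = U * diagonal (fun a => -I * (θ a : ℂ)) * star U) (hθ : ∀ a, |θ a| ≤ ∑ i, c i)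
    (X : Matrix m m ℂ) (H : ι → Matrix m m ℂ) (hH : ∀ i, dexp (Z i) (H i) = exp (Z i) * X) :
    ∑ i, c i * hs X (H i)
      ≤ ∑ a, ∑ b, ‖(star U * X * U) a b‖ ^ 2 * ((∑ i, c i) * (1 - ψ ((θ a - θ b) / 2 / ∑ i, c i))) := by
  set μ : ℝ := ∑ i, c i with hμdef
  set Y : Matrix m m ℂ := ∑ i, (c i : ℂ) • Z i with hYdef
  set X' : Matrix m m ℂ := star U * X * U with hX'
  have hπ3 : (3 : ℝ) < Real.pi := Real.pi_gt_three
  have hμ0 : 0 ≤ μ := Finset.sum_nonneg fun i _ => hc0 i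
  have hβμ : ∀ a b, |(θ a - θ b) / 2| ≤ μ := fun a b => by
    rw [abs_div, abs_two]; have := abs_sub (θ a) (θ b); linarith [hθ a, hθ b]
  rcases hμ0.lt_or_eq with hμpos | hμz
  · set ch : ι → ℝ := fun i => c i / μ with hch
    have hch0 : ∀ i, 0 ≤ ch i := fun i => div_nonneg (hc0 i) hμpos.le
    have hch1 : ∑ i, ch i = 1 := by
      rw [hch]; simp only; rw [← Finset.sum_div, div_self hμpos.ne']
    set Yh : Matrix m m ℂ := ∑ i, (ch i : ℂ) • Z i with hYhdef
    have hYhY : Yh = ((μ⁻¹ : ℝ) : ℂ) • Y := by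
      rw [hYhdef, hYdef, Finset.smul_sum]
      refine Finset.sum_congr rfl fun i _ => ?_
      rw [smul_smul, hch]
      congr 1
      push_cast
      ring
    have hfun : (fun a => -I * (((θ a / μ : ℝ)) : ℂ)) = ((μ⁻¹ : ℝ) : ℂ) • (fun a => -I * (θ a : ℂ)) := by
      funext a; simp only [Pi.smul_apply, smul_eq_mul]; push_cast; ring
    have hYhU : Yh = U * diagonal (fun a => -I * (((θ a / μ : ℝ)) : ℂ)) * star U := by
      rw [hfun, Matrix.diagonal_smul, Matrix.mul_smul, Matrix.smul_mul, ← hYU, hYhY]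
    have hYhskew : Yhᴴ = -Yh := conjTranspose_sum_smul ch hZ
    have hYhn : ‖Yh‖ ≤ 1 := by
      calc ‖Yh‖ ≤ ∑ i, ‖(ch i : ℂ) • Z i‖ := norm_sum_le _ _
        _ ≤ ∑ i, ch i := Finset.sum_le_sum fun i _ => by
            rw [norm_smul, Complex.norm_real, Real.norm_of_nonneg (hch0 i)]
            nlinarith [hZ1 i, hch0 i, norm_nonneg (Z i)]
        _ = 1 := hch1
    obtain ⟨HYh, hHYh⟩ := (dexp_lower_bound_and_surjective hYhskew one_pos (by linarith) hYhn).2 (exp Yh * X)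
    have hj := jensen_hs_le hZ hZ1 ch hch0 hch1.le X H HYh hH hHYh
    rw [hch1, sub_self, zero_mul, sub_zero] at hj
    have hβπ' : ∀ a b, |(θ a / μ - θ b / μ) / 2| < Real.pi := fun a b => by
      rw [← sub_div, div_div, mul_comm, ← div_div, abs_div, abs_of_pos hμpos, div_lt_iff₀ hμpos]
      have := hβμ a b
      nlinarith [Real.pi_gt_three]
    have h4 : hs X HYh = ∑ a, ∑ b, ‖X' a b‖ ^ 2 * (1 - ψ ((θ a / μ - θ b / μ) / 2)) :=
      hs_solution_eq hU hU' (fun a => θ a / μ) hβπ' hYhU X HYh hHYh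
    have h5 : ∑ i, c i * hs X (H i) = μ * ∑ i, ch i * hs X (H i) := by
      rw [Finset.mul_sum]
      refine Finset.sum_congr rfl fun i _ => ?_
      rw [hch]; simp only; field_simp
    calc ∑ i, c i * hs X (H i) = μ * ∑ i, ch i * hs X (H i) := h5
      _ ≤ μ * hs X HYh := mul_le_mul_of_nonneg_left hj hμpos.le
      _ = ∑ a, ∑ b, ‖X' a b‖ ^ 2 * (μ * (1 - ψ ((θ a - θ b) / 2 / μ))) := by
          rw [h4, Finset.mul_sum]
          refine Finset.sum_congr rfl fun a _ => ?_
          rw [Finset.mul_sum]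
          refine Finset.sum_congr rfl fun b _ => ?_
          rw [show (θ a / μ - θ b / μ) / 2 = (θ a - θ b) / 2 / μ by ring]
          ring
  · have hc : ∀ i, c i = 0 := fun i =>
      (Finset.sum_eq_zero_iff_of_nonneg (fun i _ => hc0 i)).1 hμz.symm i (Finset.mem_univ i)
    have h0 : ∑ i, c i * hs X (H i) = 0 := Finset.sum_eq_zero fun i _ => by rw [hc i, zero_mul]
    rw [h0, ← hμz]
    simp

/-- **The excess of the flat solution in the frame**: `hs(G♭ − X, G♭ − X) = Σ |X'_{ab}|²·((sinc β_{ab})⁻¹ − 1)²`, the quadratic form of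
`(χ(B_Y) − 1)²`. [folklore] -/
theorem hs_flat_sub_self_eq {U : Matrix m m ℂ} (hU : star U * U = 1) (hU' : U * star U = 1) (θ : m → ℝ)
    (hβ : ∀ a b, |(θ a - θ b) / 2| < Real.pi) {Z : Matrix m m ℂ}
    (hZU : Z = U * diagonal (fun a => -I * (θ a : ℂ)) * star U) (X Gf : Matrix m m ℂ)
    (hGf : dexp Z Gf = exp ((2⁻¹ : ℂ) • Z) * X * exp ((2⁻¹ : ℂ) • Z)) :
    hs (Gf - X) (Gf - X) = ∑ a, ∑ b, ‖(star U * X * U) a b‖ ^ 2 * ((Real.sinc ((θ a - θ b) / 2))⁻¹ - 1) ^ 2 := by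
  have hcoef := coef_of_dexp_eq_frame hU hU' θ hZU X Gf _ (hGf.trans (exp_half_sandwich_frame hU hU' θ hZU X))
  set X' : Matrix m m ℂ := star U * X * U with hX'
  set Gf' : Matrix m m ℂ := star U * Gf * U with hGf'
  have hXU : X = U * X' * star U := (conj_unconj hU' X).symm
  have hGfU : Gf = U * Gf' * star U := (conj_unconj hU' Gf).symm
  have hsub : Gf - X = U * (Gf' - X') * star U := by rw [hGfU, hXU]; noncomm_ring
  rw [hsub, hs_frame hU]
  refine Finset.sum_congr rfl fun a _ => Finset.sum_congr rfl fun b _ => ?_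
  obtain ⟨hne, -⟩ := dd_ratio (hβ a b)
  have hab : Gf' a b = (((Real.sinc ((θ a - θ b) / 2))⁻¹ : ℝ) : ℂ) * X' a b := by
    have h1 : Gf' a b = Complex.exp ((-I * θ a + -I * θ b) / 2) * X' a b / dd (-I * θ a) (-I * θ b) :=
      (eq_div_iff hne).2 (by rw [mul_comm]; exact hcoef a b)
    rw [h1, mul_div_right_comm, exp_half_div_dd (hβ a b)]
  rw [Matrix.sub_apply, hab, show (((Real.sinc ((θ a - θ b) / 2))⁻¹ : ℝ) : ℂ) * X' a b - X' a b
      = ((((Real.sinc ((θ a - θ b) / 2))⁻¹ - 1 : ℝ)) : ℂ) * X' a b by push_cast; ring,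
    Complex.star_def, Complex.conj_mul', ← Complex.ofReal_pow, Complex.ofReal_re, norm_mul, Complex.norm_real,
    Real.norm_eq_abs, mul_pow, sq_abs, mul_comm]

/-- ★★ **STRENGTHENED SHARP COERCIVITY** `Q ⪰ λ·χ(B_Y) + (λ∕2)·(χ(B_Y) − 1)²`, `λ = 1 − Σcᵢ`: under the hypotheses of
`sharp_coercive`,  `λ·hs(X, G♭) + (λ∕2)·hs(G♭ − X, G♭ − X) ≤ hs(X, H_Y) − Σcᵢ·hs(X, Hᵢ)`  — the perspective Jensen is the same;
entrywise the scalar input is (S3) `persp_scalar_strong` instead of `persp_scalar`. [folklore] -/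
theorem sharp_coercive_strong {Z : ι → Matrix m m ℂ} (hZ : ∀ i, (Z i)ᴴ = -Z i) (hZ1 : ∀ i, ‖Z i‖ ≤ 1)
    (c : ι → ℝ) (hc0 : ∀ i, 0 ≤ c i) (hc1 : ∑ i, c i ≤ 1) (X : Matrix m m ℂ) (H : ι → Matrix m m ℂ) (HY Gf : Matrix m m ℂ)
    (hH : ∀ i, dexp (Z i) (H i) = exp (Z i) * X)
    (hY : dexp (∑ i, (c i : ℂ) • Z i) HY = exp (∑ i, (c i : ℂ) • Z i) * X)
    (hGf : dexp (∑ i, (c i : ℂ) • Z i) Gf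
      = exp ((2⁻¹ : ℂ) • ∑ i, (c i : ℂ) • Z i) * X * exp ((2⁻¹ : ℂ) • ∑ i, (c i : ℂ) • Z i)) :
    (1 - ∑ i, c i) * hs X Gf + (1 - ∑ i, c i) / 2 * hs (Gf - X) (Gf - X) ≤ hs X HY - ∑ i, c i * hs X (H i) := by
  set μ : ℝ := ∑ i, c i with hμdef
  set Y : Matrix m m ℂ := ∑ i, (c i : ℂ) • Z i with hYdef
  have hπ3 : (3 : ℝ) < Real.pi := Real.pi_gt_three
  have hYskew : Yᴴ = -Y := conjTranspose_sum_smul c hZ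
  have hYn : ‖Y‖ ≤ μ := by
    calc ‖Y‖ ≤ ∑ i, ‖(c i : ℂ) • Z i‖ := norm_sum_le _ _
      _ ≤ ∑ i, c i := Finset.sum_le_sum fun i _ => by
          rw [norm_smul, Complex.norm_real, Real.norm_of_nonneg (hc0 i)]
          nlinarith [hZ1 i, hc0 i, norm_nonneg (Z i)]
  obtain ⟨U, θ, hU, hU', hYU, hθ⟩ := frame hYskew
  have hθμ : ∀ a, |θ a| ≤ μ := fun a => (hθ a).trans hYn
  have hβμ : ∀ a b, |(θ a - θ b) / 2| ≤ μ := fun a b => by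
    rw [abs_div, abs_two]; have := abs_sub (θ a) (θ b); linarith [hθμ a, hθμ b]
  have hβπ : ∀ a b, |(θ a - θ b) / 2| < Real.pi := fun a b => by linarith [hβμ a b]
  set X' : Matrix m m ℂ := star U * X * U with hX'
  have h1 : hs X HY = ∑ a, ∑ b, ‖X' a b‖ ^ 2 * (1 - ψ ((θ a - θ b) / 2)) :=
    hs_solution_eq hU hU' θ hβπ hYU X HY hY
  have h2 : hs X Gf = ∑ a, ∑ b, ‖X' a b‖ ^ 2 * (Real.sinc ((θ a - θ b) / 2))⁻¹ :=
    hs_flat_solution_eq hU hU' θ hβπ hYU X Gf hGf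
  have h2' : hs (Gf - X) (Gf - X) = ∑ a, ∑ b, ‖X' a b‖ ^ 2 * ((Real.sinc ((θ a - θ b) / 2))⁻¹ - 1) ^ 2 :=
    hs_flat_sub_self_eq hU hU' θ hβπ hYU X Gf hGf
  have h3 := sum_hs_le_persp_frame hU hU' θ hZ hZ1 c hc0 hYU hθμ X H hH
  have h6 : ∀ a b, (1 - μ) * (‖X' a b‖ ^ 2 * (Real.sinc ((θ a - θ b) / 2))⁻¹)
      + (1 - μ) / 2 * (‖X' a b‖ ^ 2 * ((Real.sinc ((θ a - θ b) / 2))⁻¹ - 1) ^ 2)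
      + ‖X' a b‖ ^ 2 * (μ * (1 - ψ ((θ a - θ b) / 2 / μ))) ≤ ‖X' a b‖ ^ 2 * (1 - ψ ((θ a - θ b) / 2)) := by
    intro a b
    have hp := mul_le_mul_of_nonneg_left (persp_scalar_strong (hβμ a b) hc1) (sq_nonneg ‖X' a b‖)
    nlinarith [hp]
  have h7 : (1 - μ) * (∑ a, ∑ b, ‖X' a b‖ ^ 2 * (Real.sinc ((θ a - θ b) / 2))⁻¹)
      + (1 - μ) / 2 * (∑ a, ∑ b, ‖X' a b‖ ^ 2 * ((Real.sinc ((θ a - θ b) / 2))⁻¹ - 1) ^ 2)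
      + ∑ a, ∑ b, ‖X' a b‖ ^ 2 * (μ * (1 - ψ ((θ a - θ b) / 2 / μ)))
      ≤ ∑ a, ∑ b, ‖X' a b‖ ^ 2 * (1 - ψ ((θ a - θ b) / 2)) := by
    rw [Finset.mul_sum, Finset.mul_sum, ← Finset.sum_add_distrib, ← Finset.sum_add_distrib]
    refine Finset.sum_le_sum fun a _ => ?_
    rw [Finset.mul_sum, Finset.mul_sum, ← Finset.sum_add_distrib, ← Finset.sum_add_distrib]
    exact Finset.sum_le_sum fun b _ => h6 a b
  rw [h1, h2, h2']
  linarith [h3, h7]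

/-! ## §3 The sharp Hilbert–Schmidt lower bound `‖D K_W(W X)‖ ≥ (1 − Σcᵢ)·‖X‖` -/

omit [Fintype m] [DecidableEq m] [Nonempty m] [Fintype ι] in
/-- **Entrywise completion of the square.**  For `x g : ℂ`, `0 < s ≤ 1`, `0 ≤ λ`:
`s²|g|² − λ²|x|² ≥ 2λ·(Re(x̄g) − (λ∕s)|x|² − (λ∕2)(s⁻¹ − 1)²|x|²)` — with `p = g − (λ∕s)x` it is
`(s|p| − λ(s⁻¹ − 1)|x|)² + 2λ(1 − s)(|x||p| − Re(x̄p)) ≥ 0`. [folklore] -/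
theorem entry_completion (x g : ℂ) {s lam : ℝ} (hs0 : 0 < s) (hs1 : s ≤ 1) (hl : 0 ≤ lam) :
    2 * lam * ((star x * g).re - lam * s⁻¹ * ‖x‖ ^ 2 - lam / 2 * (s⁻¹ - 1) ^ 2 * ‖x‖ ^ 2)
      ≤ s ^ 2 * ‖g‖ ^ 2 - lam ^ 2 * ‖x‖ ^ 2 := by
  set p : ℂ := g - ((lam * s⁻¹ : ℝ) : ℂ) * x with hp
  have hg : g = ((lam * s⁻¹ : ℝ) : ℂ) * x + p := by rw [hp]; ring
  have hre : (star x * g).re = lam * s⁻¹ * ‖x‖ ^ 2 + (star x * p).re := by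
    rw [hg, mul_add, Complex.add_re, ← mul_assoc, mul_comm (star x) _, mul_assoc, Complex.re_ofReal_mul,
      Complex.star_def, Complex.conj_mul', ← Complex.ofReal_pow, Complex.ofReal_re]
  have hnorm : ‖g‖ ^ 2 = (lam * s⁻¹) ^ 2 * ‖x‖ ^ 2 + ‖p‖ ^ 2 + 2 * (lam * s⁻¹) * (star x * p).re := by
    rw [hg, ← Complex.normSq_eq_norm_sq, Complex.normSq_add, Complex.normSq_eq_norm_sq, Complex.normSq_eq_norm_sq,
      norm_mul, Complex.norm_real, Real.norm_of_nonneg (by positivity), mul_pow]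
    congr 1
    rw [mul_assoc (2 : ℝ), mul_assoc, Complex.re_ofReal_mul]
    congr 2
    rw [Complex.star_def, ← Complex.conj_conj (x * _), map_mul, Complex.conj_conj, Complex.conj_re, mul_comm]
  have hcs : (star x * p).re ≤ ‖x‖ * ‖p‖ := by
    calc (star x * p).re ≤ ‖star x * p‖ := Complex.re_le_norm _
      _ = ‖x‖ * ‖p‖ := by rw [norm_mul, norm_star]
  have h1s : 0 ≤ 1 - s := by linarith
  have hsinv : s⁻¹ - 1 = (1 - s) * s⁻¹ := by field_simp
  rw [hre, hnorm, hsinv]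
  set u : ℝ := s⁻¹ with hu
  set R : ℝ := (star x * p).re with hR
  have hss : s * u = 1 := mul_inv_cancel₀ hs0.ne'
  have hkey : 0 ≤ (s * ‖p‖ - lam * ((1 - s) * u) * ‖x‖) ^ 2 + 2 * lam * (1 - s) * (‖x‖ * ‖p‖ - R) := by
    have := mul_nonneg (mul_nonneg (mul_nonneg (by norm_num : (0:ℝ) ≤ 2) hl) h1s) (sub_nonneg.2 hcs)
    positivity
  have e3 : (s * ‖p‖ - lam * ((1 - s) * u) * ‖x‖) ^ 2 + 2 * lam * (1 - s) * (‖x‖ * ‖p‖ - R)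
      = s ^ 2 * ‖p‖ ^ 2 + lam ^ 2 * (1 - s) ^ 2 * u ^ 2 * ‖x‖ ^ 2 - 2 * lam * (1 - s) * R
        + 2 * lam * (1 - s) * ‖x‖ * ‖p‖ * (1 - s * u) := by ring
  have eL : 2 * lam * (lam * u * ‖x‖ ^ 2 + R - lam * u * ‖x‖ ^ 2 - lam / 2 * ((1 - s) * u) ^ 2 * ‖x‖ ^ 2)
      = 2 * lam * R - lam ^ 2 * (1 - s) ^ 2 * u ^ 2 * ‖x‖ ^ 2 := by ring
  have eR : s ^ 2 * ((lam * u) ^ 2 * ‖x‖ ^ 2 + ‖p‖ ^ 2 + 2 * (lam * u) * R) - lam ^ 2 * ‖x‖ ^ 2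
      = s ^ 2 * ‖p‖ ^ 2 + 2 * lam * R * s * (s * u) + lam ^ 2 * ‖x‖ ^ 2 * ((s * u) ^ 2 - 1) := by ring
  rw [e3, hss] at hkey
  rw [eL, eR, hss]
  nlinarith [hkey]

/-- ★★★ **THE SHARP JACOBIAN LOWER BOUND OF THE PRINTED exp-mean-log FIBRE MAP (n08-w3's conjecture, Hilbert–Schmidt form).**
For unitary `W`, unitaries `hᵢ` in the guard `‖hᵢW* − 1‖ < 1∕2`, weights `cᵢ ≥ 0` with `Σcᵢ ≤ 1` and a skew-Hermitian `X`:
  `(1 − Σcᵢ)²·hs(X, X) ≤ hs(D K_W(W X), D K_W(W X))`,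
i.e. `‖D K_W(WX)‖_HS ≥ (1 − Σcᵢ)‖X‖_HS` — `GuardJacobian.emlD_tangent_lower_bound` WITHOUT the factor `sin ρ∕ρ`; the constant is
attained at the flat background (`GuardJacobian.emlD_flat`).  PROOF: `G'` with `dexp(Y)G' = D K_W(WX)·W*` is `Q X̃`; in `Y`'s
eigenframe `‖D K_W(WX)‖² = Σ sinc²β·|g|²` (`norm_dd_eq`), `G♭ = χX̃`; `entry_completion` summed gives
`‖D K_W(WX)‖² − λ²‖X̃‖² ≥ 2λ·[hs(X̃,G') − λ·hs(X̃,G♭) − (λ∕2)·hs(G♭−X̃,G♭−X̃)] ≥ 0` by `sharp_coercive_strong`. [folklore] -/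
theorem emlD_tangent_lower_bound_sharp {h : ι → Matrix m m ℂ} (hh : ∀ i, h i ∈ unitaryGroup m ℂ) {W : Matrix m m ℂ}
    (hWu : W ∈ unitaryGroup m ℂ) (hg : ∀ i, ‖h i * star W - 1‖ < 1 / 2) {c : ι → ℝ} (hc0 : ∀ i, 0 ≤ c i)
    (hc1 : ∑ i, c i ≤ 1) (X : Matrix m m ℂ) (hX : Xᴴ = -X) :
    (1 - ∑ i, c i) ^ 2 * hs X X ≤ hs (emlD h c W (W * X)) (emlD h c W (W * X)) := by
  have hW1 : star W * W = 1 := Matrix.mem_unitaryGroup_iff'.mp hWu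
  have hW2 : W * star W = 1 := Matrix.mem_unitaryGroup_iff.mp hWu
  have hP1 : ∀ i, ‖h i * star W - 1‖ < 1 := fun i => lt_trans (hg i) (by norm_num)
  obtain ⟨hZskew, hZ1, hYskew, hYn⟩ := guard_skew_norm hh hWu hg hc0 hc1
  have hX' : star X = -X := by rw [Matrix.star_eq_conjTranspose, hX]
  have hπ3 : (3 : ℝ) < Real.pi := Real.pi_gt_three
  set μ : ℝ := ∑ i, c i with hμdef
  set Y : Matrix m m ℂ := ∑ i, (c i : ℂ) • mlog (h i * star W)
  set Xt : Matrix m m ℂ := W * X * star W with hXt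
  set E : Matrix m m ℂ := emlD h c W (W * X)
  set H : ι → Matrix m m ℂ := fun i => fderiv ℂ mlog (h i * star W) (h i * star W * Xt)
  have hHi : ∀ i, dexp (mlog (h i * star W)) (H i) = exp (mlog (h i * star W)) * Xt := fun i => by
    show dexp (mlog (h i * star W)) (fderiv ℂ mlog (h i * star W) (h i * star W * Xt)) = _
    rw [dexp_mlog_fderiv (hP1 i), MatrixLog.exp_mlog (hP1 i)]
  have hPX : ∀ i, h i * star (W * X) = -(h i * star W * Xt) := by
    intro i
    rw [star_mul, hX', neg_mul, mul_neg, hXt, show h i * star W * (W * X * star W)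
      = h i * (star W * W) * (X * star W) by noncomm_ring, hW1, mul_one]
  have hE : E * star W = exp Y * Xt - dexp Y (∑ i, (c i : ℂ) • H i) := by
    have h0 : E = exp Y * (W * X) + dexp Y (∑ i, (c i : ℂ) • fderiv ℂ mlog (h i * star W) (h i * star (W * X))) * W :=
      emlD_apply h c W (W * X)
    have h1 : (∑ i, (c i : ℂ) • fderiv ℂ mlog (h i * star W) (h i * star (W * X))) = -∑ i, (c i : ℂ) • H i := by
      rw [← Finset.sum_neg_distrib]
      refine Finset.sum_congr rfl fun i _ => ?_
      rw [hPX, map_neg, smul_neg]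
    have h0' : E = exp Y * (W * X) - dexp Y (∑ i, (c i : ℂ) • H i) * W := by
      rw [h0, h1, map_neg, neg_mul, ← sub_eq_add_neg]
    rw [h0', hXt, sub_mul, mul_assoc, mul_assoc (dexp Y _) W (star W), hW2, mul_one]
  obtain ⟨G', hG'⟩ := (dexp_lower_bound_and_surjective hYskew one_pos (by linarith) hYn).2 (E * star W)
  obtain ⟨Gf, hGf⟩ := (dexp_lower_bound_and_surjective hYskew one_pos (by linarith) hYn).2
    (exp ((2⁻¹ : ℂ) • Y) * Xt * exp ((2⁻¹ : ℂ) • Y))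
  have hY : dexp Y (G' + ∑ i, (c i : ℂ) • H i) = exp Y * Xt := by
    rw [map_add, hG', hE]; abel
  -- the strengthened coercivity at `HY := G' + Σ cᵢ Hᵢ`
  have hco := sharp_coercive_strong hZskew hZ1 c hc0 hc1 Xt H _ Gf hHi hY hGf
  have e1 : hs Xt (G' + ∑ i, (c i : ℂ) • H i) = hs Xt G' + ∑ i, c i * hs Xt (H i) := by
    rw [hs_add_right, hs_sum_right]
    congr 1
    exact Finset.sum_congr rfl fun i _ => hs_smul_right _ _ _
  rw [e1] at hco
  -- the frame of `Y`
  obtain ⟨U, θ, hU, hU', hYU, hθ⟩ := frame hYskew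
  have hβ1 : ∀ a b, |(θ a - θ b) / 2| ≤ 1 := fun a b => by
    rw [abs_div, abs_two]; have := abs_sub (θ a) (θ b); linarith [(hθ a).trans hYn, (hθ b).trans hYn]
  have hβπ : ∀ a b, |(θ a - θ b) / 2| < Real.pi := fun a b => by linarith [hβ1 a b]
  have hl : ∀ a b, Y * Fu U a b = (-I * (θ a : ℂ)) • Fu U a b := fun a b => by
    rw [hYU]; exact frame_mul_Fu hU _ a b
  have hr' : ∀ a b, Fu U a b * Y = (-I * (θ b : ℂ)) • Fu U a b := fun a b => by
    rw [hYU]; exact Fu_mul_frame hU _ a b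
  have hdexp : ∀ a b, dexp Y (Fu U a b) = dd (-I * θ a) (-I * θ b) • Fu U a b := fun a b =>
    dexp_eigen (hl a b) (hr' a b)
  set x : Matrix m m ℂ := star U * Xt * U with hx
  set gg : Matrix m m ℂ := star U * G' * U with hgg
  have hXtU : Xt = U * x * star U := (conj_unconj hU' Xt).symm
  have hG'U : G' = U * gg * star U := (conj_unconj hU' G').symm
  -- (i) ‖E‖² in the frame
  have hsinc : ∀ a b, 0 < Real.sinc ((θ a - θ b) / 2) ∧ Real.sinc ((θ a - θ b) / 2) ≤ 1 := fun a b =>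
    ⟨by rw [← norm_dd_eq (hβπ a b)]; exact norm_pos_iff.2 (dd_ratio (hβπ a b)).1, Real.sinc_le_one _⟩
  have hEE : hs E E = ∑ a, ∑ b, Real.sinc ((θ a - θ b) / 2) ^ 2 * ‖gg a b‖ ^ 2 := by
    have h1 : dexp Y G' = U * Matrix.of (fun a b => dd (-I * θ a) (-I * θ b) * gg a b) * star U := by
      rw [hG'U]; exact linmap_frame (dexp Y).toLinearMap _ hdexp gg
    rw [← hs_mul_star_unitary hW1 E E, ← hG', h1, hs_frame hU]
    refine Finset.sum_congr rfl fun a _ => Finset.sum_congr rfl fun b _ => ?_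
    rw [Matrix.of_apply, Complex.star_def, Complex.conj_mul', ← Complex.ofReal_pow, Complex.ofReal_re, norm_mul,
      norm_dd_eq (hβπ a b), mul_pow]
  -- (ii) hs Xt G', hs Xt Xt in the frame
  have hXG : hs Xt G' = ∑ a, ∑ b, (star (x a b) * gg a b).re := by
    rw [hXtU, hG'U, hs_frame hU]
  have hXX : hs Xt Xt = ∑ a, ∑ b, ‖x a b‖ ^ 2 := by
    rw [hXtU, hs_frame hU]
    refine Finset.sum_congr rfl fun a _ => Finset.sum_congr rfl fun b _ => ?_
    rw [Complex.star_def, Complex.conj_mul', ← Complex.ofReal_pow, Complex.ofReal_re]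
  -- (iii) the flat solution and its excess in the frame
  have hXGf : hs Xt Gf = ∑ a, ∑ b, ‖x a b‖ ^ 2 * (Real.sinc ((θ a - θ b) / 2))⁻¹ :=
    hs_flat_solution_eq hU hU' θ hβπ hYU Xt Gf hGf
  have hGfX : hs (Gf - Xt) (Gf - Xt) = ∑ a, ∑ b, ‖x a b‖ ^ 2 * ((Real.sinc ((θ a - θ b) / 2))⁻¹ - 1) ^ 2 :=
    hs_flat_sub_self_eq hU hU' θ hβπ hYU Xt Gf hGf
  -- (iv) entrywise completion, summed
  have hlam : 0 ≤ 1 - μ := by linarith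
  have hsum : 2 * (1 - μ) * (hs Xt G' - (1 - μ) * hs Xt Gf - (1 - μ) / 2 * hs (Gf - Xt) (Gf - Xt))
      ≤ hs E E - (1 - μ) ^ 2 * hs Xt Xt := by
    rw [hEE, hXG, hXX, hXGf, hGfX, Finset.mul_sum, Finset.mul_sum, ← Finset.sum_sub_distrib, ← Finset.sum_sub_distrib,
      Finset.mul_sum, Finset.mul_sum, ← Finset.sum_sub_distrib]
    refine Finset.sum_le_sum fun a _ => ?_
    rw [Finset.mul_sum, Finset.mul_sum, ← Finset.sum_sub_distrib, ← Finset.sum_sub_distrib, Finset.mul_sum, Finset.mul_sum,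
      ← Finset.sum_sub_distrib]
    refine Finset.sum_le_sum fun b _ => ?_
    have he := entry_completion (x a b) (gg a b) (hsinc a b).1 (hsinc a b).2 hlam
    nlinarith [he]
  have hpos : 0 ≤ hs Xt G' - (1 - μ) * hs Xt Gf - (1 - μ) / 2 * hs (Gf - Xt) (Gf - Xt) := by linarith
  have hXX' : hs Xt Xt = hs X X := by rw [hXt]; exact hs_conj hW1 X X
  rw [← hXX']
  nlinarith [hsum, hpos, hlam]

/-- **At the typed guard of the printed average on `SU(N)`** (radius `deltaSU = min(1∕3, π∕N) < 1∕2`): for `hᵢ, W ∈ SU(N)`,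
`‖D K_W(WX)‖_HS ≥ (1 − Σcᵢ)·‖X‖_HS` — ONE `W`-uniform sharp constant on the whole guard, every `N`. [folklore] -/
theorem emlD_tangent_lower_bound_sharp_specialUnitary {n : Type} [DecidableEq n] [Fintype n] [Nonempty n]
    (h : ι → Matrix.specialUnitaryGroup n ℂ) (W : Matrix.specialUnitaryGroup n ℂ)
    (hg : ∀ i, ‖(h i : Matrix n n ℂ) * star (W : Matrix n n ℂ) - 1‖ < ExpMeanLog.deltaSU n)
    {c : ι → ℝ} (hc0 : ∀ i, 0 ≤ c i) (hc1 : ∑ i, c i ≤ 1) (X : Matrix n n ℂ) (hX : Xᴴ = -X) :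
    (1 - ∑ i, c i) ^ 2 * hs X X
      ≤ hs (emlD (fun i => (h i : Matrix n n ℂ)) c W (W * X)) (emlD (fun i => (h i : Matrix n n ℂ)) c W (W * X)) := by
  have hh : ∀ i, (h i : Matrix n n ℂ) ∈ unitaryGroup n ℂ := fun i => (Matrix.mem_specialUnitaryGroup_iff.mp (h i).2).1
  have hWu : (W : Matrix n n ℂ) ∈ unitaryGroup n ℂ := (Matrix.mem_specialUnitaryGroup_iff.mp W.2).1
  have hg' : ∀ i, ‖(h i : Matrix n n ℂ) * star (W : Matrix n n ℂ) - 1‖ < 1 / 2 := fun i => by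
    have := ExpMeanLog.lt_third_of_lt_deltaSU (hg i); linarith
  exact emlD_tangent_lower_bound_sharp hh hWu hg' hc0 hc1 X hX

end Summit.QuantumFields.YangMills.BalabanUVNodes.N08HaarCompatibilityGuardJacobianSharpNorm

end
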